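import Summits.ABC.IUTFork.Cor312FrameVolumePiecesM
import Summits.ABC.IUTFork.Cor312HullDefinedDHVolArch
import Summits.ABC.IUTFork.Cor312ThetaFiniteDHVol
import HarnessLib

/-!
# [IUTchIII] Corollary 3.12, statement — "`−|log(Θ)|` is finite" for the M-LEVEL real setting over the genuine
# carriers `K_{v̲}`, `v̲ ∈ V̲`: `HullDefined` at every `(j, v_ℚ)` and `ThetaFinite` from three Θ-box conditions
# (G1-Θ unit P5a of `HOME/staging/w5/w5-d166/g4/G1-THETA-SHAPES.md`, C-lead ruling C-R12 (e) «target #2′»)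

PROOF-ONLY record file (D-0012; no definitions, no `Prop` facts) of the abc-iut cell (R2 S-chain seat abc-iut-s2-p9,
gen 0; branch C «abc ⇐ S»: the READ binder `hΘ` of `Conditional/AbcOfS*.lean` is to be discharged at the M-level
real setting whose summands ARE abc-iut-S2's genuine prime packets). TAKES NO SIDE on [IUTchIII] Cor. 3.12.

abc-iut-c312-7's `Cor312ThetaFinitePrVol` (p421738) proves, for abc-iut-c312-1's print-normalised F-LEVEL setting
`Real.settingPrVol` (carriers `F_v`, `v ∈ 𝕍(F)`), the first clause "`−|log(Θ)| ∈ ℝ`" of [IUTchIII] Cor. 3.12 (kurims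
`paper:url-4b091feeb646` p. 174 l. 16; proof p. 175 l. 2–4 "one concludes easily from the [easily verified] compactness of
the `^{1,∘}𝒰_{j,v_ℚ}` … that the quantity `−|log(Θ)|` is finite") from three transparent conditions on the Θ-box binder.
THIS file is its twin over the M-LEVEL pieces of abc-iut-w5-d166's units P1/P2′ — `Real.padicPresentationOfInitialDH`
(`Cor312VolumesPadicSummandsM`, p433804) and `Real.frameVolumePiecesOfInitialDH D hlog : FrameVolumePieces
(logShellsOfInitialDH D logvK)` (`Cor312FrameVolumePiecesM`): index skeleton abc-iut-c312-5's `Real.thetaIndexOfInitial D`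
(`V := ↥D.V = V̲`, `V_ℚ := Val ℚ`, [IUTchI] Def. 3.1 (e)), field factors of the GENUINE packets
`K_{v̲_0} ⊗_{ℚ_p} ⋯ ⊗_{ℚ_p} K_{v̲_j}` — for EVERY setting assembled from these pieces by abc-iut-c312-7's per-frame
assembler `Cor312.Setting.ofFrames` (abc-iut-c312-6's `FrameVolumePieces.settingOfFrameVolumes` is the case
`hadm := hadm_of_realizes hV`), with the Θ-boxes `thetaBox`, the `q`-centre `qCentre`, the situation's `Adm`/`logvol`
and archimedean/(b)(c) data, and the context data left as BINDERS (so that the sharp setting of unit P4, read off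
abc-iut-S2's genuine ideles, is an instance by `rfl`):

* §1 the (Ind3)-region IS `e⁻¹(⋃ₘ Θ-boxes)`, with image `⋃ₘ Θ-boxes` at a finite place (`factorMapM` is onto);
* §2 `hullDefined_ofFramesM_arc` (at `v_ℚ = ∞`, UNCONDITIONALLY: empty field-factor index) and
  `hullDefined_ofFramesM_non` (at a finite place `u` of `ℚ`, from BOUNDED and NONDEGENERATE Θ-boxes): abc-iut-c312-5's
  absorbing log-shell lattices `e⁻¹(Π_{v⃗} c·I_{v⃗})` of the presentation `presAtM D hlog u` (`exists_latticeF_of_norm_le`,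
  `family_image_latticePk` — generic over `PadicPresentation`, Dupuy–Hilado §4 "fixes the lattice") feed abc-iut-c312-10's
  generic `Cor312.Setting.hullDefined_ofFrames_of_stable` verbatim; `thetaLocal_ne_top_ofFramesM`, `thetaHull_adm_ofFramesM`;
  and the ARCHIMEDEAN LOCAL Θ-VOLUME IS `0` (`thetaLocal_ofFramesM_arc`, unit (A) of the SHAPES memo: the trivial
  archimedean container of the F-level files is kept at the M level by unit P2′);
* the GOOD-PLACE computation (hull `= e⁻¹(Π_{v⃗} (R_{v⃗})^∼)`, local Θ-volume `0`) and **`ThetaFinite`** itself are the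
  companion `Cor312ThetaFiniteMGood` (split for the 400-line rule).

[claim: Mochizuki2012, status: disputed] for the quoted sentences; [cite: DupuyHilado2025, §3.6, §4 (intro), §4.10];
[cite: Mochizuki2012, IUTchIV Thm 1.10 proof Step (vi) p. 29]; [cite: NeukirchANT1999, Ch. III Thm. (2.12)].
HONEST FRAMING: bookkeeping at the genuine carriers; no edit to any landed file; nothing here bears on the truth of
[IUTchIII] Cor. 3.12 (`Cor312.Setting.Statement` untouched); the box conditions themselves are the box provider's
statements (unit P4). typed ≠ proved; instantiated ≠ endorsed.
-/

noncomputable section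

open Set Function NumberField IsDedekindDomain Bornology
open scoped Pointwise

namespace Summit.ABC.IUTFork.Thm311.Real

open Cor312 Cor312Vol Literature.IUT.LogThetaLattice Literature.IUT.LogVolume Literature.IUT.HodgeTheaters
  Literature.NumberTheory.NumberFields

variable {F K Fbar : Type} [Field F] [NumberField F] [Field K] [NumberField K] [Algebra F K]
  [Field Fbar] [Algebra F Fbar] [Algebra K Fbar] {E : WeierstrassCurve F} [E.IsElliptic] {l : ℕ}
  {Pb : BadPlacePredicates K} (D : InitialThetaData F K Fbar E l Pb) {logvK : PadicLogsVal K}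
  (hlog : LogvAnalyticVal logvK)

/-! ## §0. Small index facts at the M level -/

/-- The `(j+1)`-capsule at a label `j = i + 1 ∈ 𝔽_l^⋇` has at least two members (M-level twin of abc-iut-c312-5's
`two_le_card_caps_labelSucc`). [folklore] -/
theorem two_le_card_caps_labelSucc_M (i : Fin (thetaIndexOfInitial D).lstar) :
    2 ≤ Fintype.card ((thetaIndexOfInitial D).Caps (Setting.labelSucc i)) := by
  rw [show Fintype.card ((thetaIndexOfInitial D).Caps (Setting.labelSucc i)) =
      (Setting.labelSucc (T := thetaIndexOfInitial D) i : ℕ) + 1 from Fintype.card_fin _, Setting.labelSucc,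
    Fin.val_succ]
  omega

/-- **Every `K_{v̲}`, `v̲ | p_u`, of the M-level presentation is absolutely unramified when `p_u ∤ disc(K)`** (its field IS
abc-iut-S7's rescaled completion of `K`; Dedekind's discriminant theorem). [cite: NeukirchANT1999, Ch. III Thm. (2.12)] -/
theorem absRamificationIdx_presAtM_eq_one (u : FinitePlace ℚ) (hdisc : ¬ ((ratChar u : ℕ) : ℤ) ∣ NumberField.discr K)
    (x : (thetaIndexOfInitial D).Fibre (Val.non u)) :
    absRamificationIdx (ratChar u) ((presAtM D hlog u).k x) = 1 :=
  absRamificationIdx_rescaledCompletion_eq_one_of_not_dvd_discr K (ratChar u) (placeOfM D u x)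
    (natCast_mem_placeOfM D (ratChar u) u (natCast_ratChar_mem u) x) hdisc

/-- The finite places of `ℚ` whose prime divides a nonzero natural number form a finite set (each fibre of `u ↦ p_u` is
abc-iut-c312-3's finite `placesOver ℚ p`). [folklore] -/
theorem finite_finitePlace_ratChar_dvd {N : ℕ} (hN : N ≠ 0) : {u : FinitePlace ℚ | ratChar u ∣ N}.Finite := by
  have hsub : {u : FinitePlace ℚ | ratChar u ∣ N} ⊆
      ⋃ p ∈ N.divisors, {u : FinitePlace ℚ | ratChar u = p} := by
    intro u hu
    simp only [Set.mem_iUnion, Set.mem_setOf_eq, exists_prop]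
    exact ⟨ratChar u, Nat.mem_divisors.mpr ⟨hu, hN⟩, rfl⟩
  refine Set.Finite.subset (Set.Finite.biUnion (Finset.finite_toSet _) fun p hp => ?_) hsub
  by_cases hprime : p.Prime
  · haveI : Fact p.Prime := ⟨hprime⟩
    have hsub' : {u : FinitePlace ℚ | ratChar u = p} ⊆
        (fun u : FinitePlace ℚ => FinitePlace.maximalIdeal u) ⁻¹' (placesOver ℚ p : Set (HeightOneSpectrum (𝓞 ℚ))) := by
      intro u hu
      show FinitePlace.maximalIdeal u ∈ (placesOver ℚ p : Set (HeightOneSpectrum (𝓞 ℚ)))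
      rw [Finset.mem_coe, mem_placesOver_iff_residueChar]
      exact hu
    exact ((Finset.finite_toSet _).preimage FinitePlace.maximalIdeal_injective.injOn).subset hsub'
  · have hempty : {u : FinitePlace ℚ | ratChar u = p} = ∅ := by
      ext u
      simp only [Set.mem_setOf_eq, Set.mem_empty_iff_false, iff_false]
      intro h
      exact hprime (h ▸ (fact_ratChar_prime u).out)
    rw [hempty]
    exact Set.finite_empty

/-- A finite place of `ℚ` whose prime does not divide `2·|disc(K)|` is odd and unramified in `K` (abc-iut-c312-7's
`good_of_not_dvd` at the number field `K`). [folklore] -/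
theorem good_of_not_dvd_M (u : FinitePlace ℚ) (h : ¬ ratChar u ∣ 2 * (NumberField.discr K).natAbs) :
    2 < ratChar u ∧ ¬ ((ratChar u : ℕ) : ℤ) ∣ NumberField.discr K :=
  good_of_not_dvd (F := K) ⟨ratChar u, (fact_ratChar_prime u).out⟩ h

section Setting

variable (M : Type) [Field M] [NumberField M]
  (archPk : ∀ (j : (thetaIndexOfInitial D).Label) (vQ : (thetaIndexOfInitial D).VQ),
    Set ((logShellsOfInitialDH D logvK).Packet j vQ))
  (archSub : ∀ (j : (thetaIndexOfInitial D).Label) (v : (thetaIndexOfInitial D).V),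
    Set ((logShellsOfInitialDH D logvK).Packet j ((thetaIndexOfInitial D).over v)))
  (Adm : ∀ (j : (thetaIndexOfInitial D).Label) (vQ : (thetaIndexOfInitial D).VQ),
    Set ((logShellsOfInitialDH D logvK).Packet j vQ) → Prop)
  (logvol : ∀ (j : (thetaIndexOfInitial D).Label) (vQ : (thetaIndexOfInitial D).VQ),
    Set ((logShellsOfInitialDH D logvK).Packet j vQ) → ℝ)
  (Ψ : ℤ → ∀ v : (thetaIndexOfInitial D).V, v ∈ (thetaIndexOfInitial D).Vbad →
    Set ((logShellsOfInitialDH D logvK).StarPacket v))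
  (act : ℤ → ∀ v : (thetaIndexOfInitial D).V, v ∈ (thetaIndexOfInitial D).Vbad →
    (logShellsOfInitialDH D logvK).StarPacket v → Module.End ℚ ((logShellsOfInitialDH D logvK).StarPacket v))
  (Mmod : ℤ → ∀ j : (thetaIndexOfInitial D).LabelStar, Set ((logShellsOfInitialDH D logvK).GlobalPacket j.1))
  (region : ℤ → ∀ j : (thetaIndexOfInitial D).LabelStar, FinDivisor M → ∀ vQ : (thetaIndexOfInitial D).VQ,
    Set ((logShellsOfInitialDH D logvK).Packet j.1 vQ))
  (n : ℤ) {HT : Type} {LogLink : HT → HT → Type} {IsFull : ∀ {s t : HT}, LogLink s t → Prop}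
  (lat : LGPGaussianLogThetaLattice LogLink IsFull)
  {Frd : Type} {IsoF : Frd → Frd → Type} {Ob : Frd → Type} {realify : Frd → Frd} {Strip : Type}
  {IsoS : Strip → Strip → Type} {Mv : ∀ v : (thetaIndexOfInitial D).V, v ∈ (thetaIndexOfInitial D).Vbad → Type}
  [∀ v h, Monoid (Mv v h)]
  (sig : GlobalLGPFrobenioidSignature (thetaIndexOfInitial D).lstar (thetaIndexOfInitial D).V
    (· ∈ (thetaIndexOfInitial D).Vbad) Frd IsoF Ob realify Strip IsoS Mv)
  (split : SplittingMonoids Mv) {ObΔ : Type} {N : ∀ v : (thetaIndexOfInitial D).V, v ∈ (thetaIndexOfInitial D).Vbad → Type}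
  [∀ v h, Monoid (N v h)] (qData : QPilotData ObΔ N)
  (thetaBox : ℤ → Ob sig.Clgp → ∀ (j : (thetaIndexOfInitial D).Label) (vQ : (thetaIndexOfInitial D).VQ),
    Set (∀ s : factorIdxM D hlog j vQ, factorFieldM D hlog j vQ s))
  (qCentre : ObΔ → ∀ (j : (thetaIndexOfInitial D).Label) (vQ : (thetaIndexOfInitial D).VQ),
    ∀ s : factorIdxM D hlog j vQ, factorFieldM D hlog j vQ s)
  (hq : ∀ j vQ s, qCentre (qPilotObject qData) j vQ s ≠ 0)
  (hadm : ∀ (j : (thetaIndexOfInitial D).Label) (vQ : (thetaIndexOfInitial D).VQ)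
    (H : Set (∀ s : factorIdxM D hlog j vQ, factorFieldM D hlog j vQ s)), IsHullSet (factorFieldM D hlog j vQ) H →
      ((Situation.ofShells (logShellsOfInitialDH D logvK) M archPk archSub Adm logvol Ψ act Mmod region).D n).Adm j vQ
        (factorMapM D hlog j vQ ⁻¹' H))
  (hfin : ∀ j : (thetaIndexOfInitial D).Label, (Function.support fun vQ =>
    ((Situation.ofShells (logShellsOfInitialDH D logvK) M archPk archSub Adm logvol Ψ act Mmod region).D n).logvol j vQ
      (factorMapM D hlog j vQ ⁻¹' hullSet (factorFieldM D hlog j vQ) (qCentre (qPilotObject qData) j vQ))).Finite)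

/-! ## §1. The (Ind3)-region of the assembled M-level setting is `e⁻¹(⋃ₘ Θ-boxes)` -/

/-- The (Ind3)-enlarged Θ-region of the per-frame M-level setting at `(j, v_ℚ)` IS the preimage under the field-factor
comparison `factorMapM` of the union over `m` of the Θ-boxes of the Θ-pilot object (abc-iut-c312-7's `Setting.ofFrames`
glue, per `m`). [folklore] -/
theorem thetaRegion3_ofFramesM (j : (thetaIndexOfInitial D).Label) (vQ : (thetaIndexOfInitial D).VQ) :
    (Setting.ofFrames n lat sig split qData
        ((frameVolumePiecesOfInitialDH D hlog).toRealFrames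
          (S := Situation.ofShells (logShellsOfInitialDH D logvK) M archPk archSub Adm logvol Ψ act Mmod region)
          thetaBox qCentre) hq hadm hfin).thetaRegion3 j vQ =
      factorMapM D hlog j vQ ⁻¹' ⋃ m : ℤ, thetaBox m (thetaPilotObject sig split) j vQ := by
  rw [Set.preimage_iUnion]
  rfl

/-- At a finite place of `ℚ`, the image of the (Ind3)-region under the field-factor comparison IS the union of the
Θ-boxes (`factorMapM` is onto, unit P2′ `factorMapM_surjective`). [folklore] -/
theorem image_thetaRegion3_ofFramesM (j : (thetaIndexOfInitial D).Label) (vQ : (thetaIndexOfInitial D).VQ) :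
    factorMapM D hlog j vQ ''
        (Setting.ofFrames n lat sig split qData
          ((frameVolumePiecesOfInitialDH D hlog).toRealFrames
            (S := Situation.ofShells (logShellsOfInitialDH D logvK) M archPk archSub Adm logvol Ψ act Mmod region)
            thetaBox qCentre) hq hadm hfin).thetaRegion3 j vQ =
      ⋃ m : ℤ, thetaBox m (thetaPilotObject sig split) j vQ := by
  rw [thetaRegion3_ofFramesM]
  exact Set.image_preimage_eq _ (factorMapM_surjective D hlog j vQ)

/-! ## §2. `HullDefined`: unconditionally at `∞`, from BOUNDED and NONDEGENERATE Θ-boxes at a finite place -/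

/-- **`HullDefined` at the archimedean place of `ℚ`, UNCONDITIONALLY** (empty field-factor index there: the modelling
choice of the F-level files' trivial archimedean container, kept by unit P2′; the real frame on a `PEmpty`-indexed product
regards every subset as bounded and nondegenerate). [claim: Mochizuki2012, status: disputed] -/
theorem hullDefined_ofFramesM_arc (j : (thetaIndexOfInitial D).Label) (w : InfinitePlace ℚ) :
    (Setting.ofFrames n lat sig split qData
        ((frameVolumePiecesOfInitialDH D hlog).toRealFrames
          (S := Situation.ofShells (logShellsOfInitialDH D logvK) M archPk archSub Adm logvol Ψ act Mmod region)
          thetaBox qCentre) hq hadm hfin).HullDefined j (Val.arc w) := by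
  refine ⟨isBounded_iff_forall_norm_le.2 ⟨0, fun z _ => (pi_norm_le_iff_of_nonneg le_rfl).2 fun s => s.elim⟩,
    fun s => s.elim⟩

/-- **`HullDefined` at a finite place `u` of `ℚ` from two conditions on the Θ-boxes** (M-level twin of abc-iut-c312-7's
`hullDefined_settingPrVol_inr`): if the union over `m` of the Θ-boxes of the Θ-pilot object at `(j, u)` is BOUNDED
(Dupuy–Hilado (4.10)) and NONDEGENERATE, then the union of ALL possible images of the Θ-pilot object at `(j, u)` is
relatively compact and admits its holomorphic hull ([IUTchIII] proof of Cor. 3.12, p. 175 l. 2–4 "compactness of the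
`^{1,∘}𝒰_{j,v_ℚ}`"). PROOF: the bounded union is absorbed by a log-shell lattice `Π_{v⃗} c·I_{v⃗}` of the GENUINE packets
(`exists_latticeF_of_norm_le` at `presAtM D hlog u`), every (Ind1)/(Ind2) generator of the M-level signature fixes
`e⁻¹(Π_{v⃗} c·I_{v⃗})` (`family_image_latticePk`), and abc-iut-c312-10's `hullDefined_ofFrames_of_stable` applies with the bounded
stable `W = e⁻¹(Π_{v⃗} c·I_{v⃗})`. [claim: Mochizuki2012, status: disputed] -/
theorem hullDefined_ofFramesM_non (j : (thetaIndexOfInitial D).Label) (u : FinitePlace ℚ)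
    (hbdd : Bornology.IsBounded (⋃ m : ℤ, thetaBox m (thetaPilotObject sig split) j (Val.non u)))
    (hnd : IsNondegenerate (factorFieldM D hlog j (Val.non u))
      (⋃ m : ℤ, thetaBox m (thetaPilotObject sig split) j (Val.non u))) :
    (Setting.ofFrames n lat sig split qData
        ((frameVolumePiecesOfInitialDH D hlog).toRealFrames
          (S := Situation.ofShells (logShellsOfInitialDH D logvK) M archPk archSub Adm logvol Ψ act Mmod region)
          thetaBox qCentre) hq hadm hfin).HullDefined j (Val.non u) := by
  -- the bounded union of boxes is absorbed by a lattice `Π_{v⃗} c·I_{v⃗}` of the genuine packets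
  obtain ⟨R, hR⟩ := isBounded_iff_forall_norm_le.1 hbdd
  obtain ⟨c, -, hcR⟩ := (presAtM D hlog u).exists_latticeF_of_norm_le (j := j) R
  have hsub : (⋃ m : ℤ, thetaBox m (thetaPilotObject sig split) j (Val.non u)) ⊆ (presAtM D hlog u).latticeF j c :=
    fun z hz => hcR z fun s => (norm_le_pi_norm z s).trans (hR z hz)
  -- abc-iut-c312-10's criterion for the per-frame assembler with `W = e⁻¹(Π_{v⃗} c·I_{v⃗})`
  refine Setting.hullDefined_ofFrames_of_stable n lat sig split qData
    ((frameVolumePiecesOfInitialDH D hlog).toRealFrames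
      (S := Situation.ofShells (logShellsOfInitialDH D logvK) M archPk archSub Adm logvol Ψ act Mmod region)
      thetaBox qCentre) hq hadm hfin j (Val.non u) ((presAtM D hlog u).latticePk j c)
    (fun Φ hΦ => (presAtM D hlog u).family_image_latticePk hΦ j c) ?_ ?_ ?_ ?_
  · -- the (Ind3)-region lies in `W`
    intro x hx
    have hx' : factorMapM D hlog j (Val.non u) x ∈ ⋃ m : ℤ, thetaBox m (thetaPilotObject sig split) j (Val.non u) := by
      change x ∈ (Setting.ofFrames n lat sig split qData
        ((frameVolumePiecesOfInitialDH D hlog).toRealFrames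
          (S := Situation.ofShells (logShellsOfInitialDH D logvK) M archPk archSub Adm logvol Ψ act Mmod region)
          thetaBox qCentre) hq hadm hfin).thetaRegion3 j (Val.non u) at hx
      rw [thetaRegion3_ofFramesM] at hx
      exact hx
    have h2 := hsub hx'
    rw [← (presAtM D hlog u).preimage_latticeF_comparison c]
    exact h2
  · -- `e '' W = latticeF c` is bounded
    obtain ⟨R', hR'0, hR'⟩ := (presAtM D hlog u).exists_norm_le_of_mem_latticeF (j := j) c
    have himg : factorMapM D hlog j (Val.non u) '' (presAtM D hlog u).latticePk j c = (presAtM D hlog u).latticeF j c :=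
      (presAtM D hlog u).image_latticePk c
    refine isBounded_iff_forall_norm_le.2 ⟨R', fun z hz => (pi_norm_le_iff_of_nonneg hR'0).2 (hR' z ?_)⟩
    rw [← himg]
    exact hz
  · -- the image of the (Ind3)-region is the union of the boxes, nondegenerate by hypothesis
    change IsNondegenerate (factorFieldM D hlog j (Val.non u)) (factorMapM D hlog j (Val.non u) ''
      (Setting.ofFrames n lat sig split qData
        ((frameVolumePiecesOfInitialDH D hlog).toRealFrames
          (S := Situation.ofShells (logShellsOfInitialDH D logvK) M archPk archSub Adm logvol Ψ act Mmod region)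
          thetaBox qCentre) hq hadm hfin).thetaRegion3 j (Val.non u))
    rw [image_thetaRegion3_ofFramesM]
    exact hnd
  · -- nondegeneracy is monotone
    exact fun U U' hUU' hU => Setting.isNondegenerate_mono hUU' hU

/-- **`HullDefined` at every `(j, v_ℚ)`** from bounded nondegenerate Θ-boxes at the finite places of `ℚ`.
[claim: Mochizuki2012, status: disputed] -/
theorem hullDefined_ofFramesM (j : (thetaIndexOfInitial D).Label)
    (hbdd : ∀ u : FinitePlace ℚ, Bornology.IsBounded (⋃ m : ℤ, thetaBox m (thetaPilotObject sig split) j (Val.non u)))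
    (hnd : ∀ u : FinitePlace ℚ, IsNondegenerate (factorFieldM D hlog j (Val.non u))
      (⋃ m : ℤ, thetaBox m (thetaPilotObject sig split) j (Val.non u))) :
    ∀ vQ : (thetaIndexOfInitial D).VQ,
      (Setting.ofFrames n lat sig split qData
        ((frameVolumePiecesOfInitialDH D hlog).toRealFrames
          (S := Situation.ofShells (logShellsOfInitialDH D logvK) M archPk archSub Adm logvol Ψ act Mmod region)
          thetaBox qCentre) hq hadm hfin).HullDefined j vQ
  | .inl w => hullDefined_ofFramesM_arc D hlog M archPk archSub Adm logvol Ψ act Mmod region n lat sig split qData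
      thetaBox qCentre hq hadm hfin j w
  | .inr u => hullDefined_ofFramesM_non D hlog M archPk archSub Adm logvol Ψ act Mmod region n lat sig split qData
      thetaBox qCentre hq hadm hfin j u (hbdd u) (hnd u)

/-- **The local Θ-volume is a real number at every `(j, v_ℚ)`** (not `+∞`: "`−|log(Θ)|` is finite" locally) for the
per-frame M-level setting. [claim: Mochizuki2012, status: disputed] -/
theorem thetaLocal_ne_top_ofFramesM (j : (thetaIndexOfInitial D).Label)
    (hbdd : ∀ u : FinitePlace ℚ, Bornology.IsBounded (⋃ m : ℤ, thetaBox m (thetaPilotObject sig split) j (Val.non u)))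
    (hnd : ∀ u : FinitePlace ℚ, IsNondegenerate (factorFieldM D hlog j (Val.non u))
      (⋃ m : ℤ, thetaBox m (thetaPilotObject sig split) j (Val.non u))) (vQ : (thetaIndexOfInitial D).VQ) :
    (Setting.ofFrames n lat sig split qData
        ((frameVolumePiecesOfInitialDH D hlog).toRealFrames
          (S := Situation.ofShells (logShellsOfInitialDH D logvK) M archPk archSub Adm logvol Ψ act Mmod region)
          thetaBox qCentre) hq hadm hfin).thetaLocal j vQ ≠ ⊤ := by
  unfold Setting.thetaLocal
  rw [if_pos (hullDefined_ofFramesM D hlog M archPk archSub Adm logvol Ψ act Mmod region n lat sig split qData thetaBox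
    qCentre hq hadm hfin j hbdd hnd vQ)]
  exact WithTop.coe_ne_top

/-- The hull `^{n,∘}𝒰_{j,v_ℚ}` of the union of the possible images is then an ADMISSIBLE region of the situation's line-`n`
container (abc-iut-c312-7's `thetaHull_adm`). [claim: Mochizuki2012, status: disputed] -/
theorem thetaHull_adm_ofFramesM (j : (thetaIndexOfInitial D).Label)
    (hbdd : ∀ u : FinitePlace ℚ, Bornology.IsBounded (⋃ m : ℤ, thetaBox m (thetaPilotObject sig split) j (Val.non u)))
    (hnd : ∀ u : FinitePlace ℚ, IsNondegenerate (factorFieldM D hlog j (Val.non u))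
      (⋃ m : ℤ, thetaBox m (thetaPilotObject sig split) j (Val.non u))) (vQ : (thetaIndexOfInitial D).VQ) :
    ((Situation.ofShells (logShellsOfInitialDH D logvK) M archPk archSub Adm logvol Ψ act Mmod region).D n).Adm j vQ
      ((Setting.ofFrames n lat sig split qData
        ((frameVolumePiecesOfInitialDH D hlog).toRealFrames
          (S := Situation.ofShells (logShellsOfInitialDH D logvK) M archPk archSub Adm logvol Ψ act Mmod region)
          thetaBox qCentre) hq hadm hfin).thetaHull j vQ) :=
  (Setting.ofFrames n lat sig split qData
    ((frameVolumePiecesOfInitialDH D hlog).toRealFrames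
      (S := Situation.ofShells (logShellsOfInitialDH D logvK) M archPk archSub Adm logvol Ψ act Mmod region)
      thetaBox qCentre) hq hadm hfin).thetaHull_adm
    (hullDefined_ofFramesM D hlog M archPk archSub Adm logvol Ψ act Mmod region n lat sig split qData thetaBox qCentre hq
      hadm hfin j hbdd hnd vQ)

/-- **The ARCHIMEDEAN local Θ-volume of the per-frame M-level setting is `0`** when the situation's line `n` carries the
field-box volumes of unit P2′ (`FrameVolumePieces.Realizes`): the hull is some subset of a `PEmpty`-indexed product and the
pieces' log-volume there is an empty sum (unit (A) of the SHAPES memo — the archimedean summand `((l+5)/4)·log π` of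
abc-iut-S2's genuine number is NOT seen by this container, whence only `≤` in unit P6). [claim: Mochizuki2012, status: disputed] -/
theorem thetaLocal_ofFramesM_arc
    (hV : (frameVolumePiecesOfInitialDH D hlog).Realizes
      ((Situation.ofShells (logShellsOfInitialDH D logvK) M archPk archSub Adm logvol Ψ act Mmod region).D n))
    (j : (thetaIndexOfInitial D).Label) (w : InfinitePlace ℚ) :
    (Setting.ofFrames n lat sig split qData
        ((frameVolumePiecesOfInitialDH D hlog).toRealFrames
          (S := Situation.ofShells (logShellsOfInitialDH D logvK) M archPk archSub Adm logvol Ψ act Mmod region)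
          thetaBox qCentre) hq hadm hfin).thetaLocal j (Val.arc w) = ((0 : ℝ) : WithTop ℝ) := by
  unfold Setting.thetaLocal
  rw [if_pos (hullDefined_ofFramesM_arc D hlog M archPk archSub Adm logvol Ψ act Mmod region n lat sig split qData thetaBox
    qCentre hq hadm hfin j w)]
  congr 1
  rw [show (Setting.ofFrames n lat sig split qData
        ((frameVolumePiecesOfInitialDH D hlog).toRealFrames
          (S := Situation.ofShells (logShellsOfInitialDH D logvK) M archPk archSub Adm logvol Ψ act Mmod region)
          thetaBox qCentre) hq hadm hfin).n = n from rfl, hV.logvol_eq]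
  unfold FrameVolumePieces.logvol
  exact Finset.sum_eq_zero fun s _ => s.elim

end Setting

end Summit.ABC.IUTFork.Thm311.Real

end
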